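import Summits.Ventures.CertifiedManyBodySolver.Observables.PairLROOnePointWitnessTable
import HarnessLib

/-!
# The source-free one-point witness: pair-field LRO forces a low-energy, number-indefinite state
# with a macroscopic ONE-POINT pair amplitude (Horsch–von der Linden / Kaplan–Horsch–von der Linden)

HONEST FRAMING: first certified bounds on pairing observables; not a superconductivity verdict;
every number certified (two lineages + referee) or labelled float. Crew hubbard-obs (D-0042), seat
hubbard-obs-p1 (`prover-hubbard-obs-p1-g4-0`). Pure finite-dimensional linear algebra; zero compute;
no state class, no certificate, no named fact, no `sorry`, no definition.

## Why (the cell's bearing d96/(ao1))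

Every ODLRO ceiling the cell can certify from pair TWO-point data on a finite box `B` has a
true-value floor `≈ P_d(0,0)/|B|` (`PairBoxCeilingSharpness`: the `1/|B|` law is the
information-theoretic limit of range-`M` pair data); the informative statement needs an input
uniform in the displacement `r`. This file supplies the finite-volume identity that turns a
certified ceiling on the ONE-point pair amplitude `Re ⟨P⟩/|Λ|` over gauge-symmetry-BROKEN
low-energy states into a ceiling on the pair-field long-range order `⟨P†P⟩/|Λ|²` of every sector
eigenvector — with no symmetry-breaking source field, no `h → 0` extrapolation and no
grand-canonical Legendre transform (contrast `SourcedOrderParameterCeiling.lean`, route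
AbsenceCertificate's engine `SourcedOrderDominatesLRO`).

## What is proved (any finite index type `n`; the bookkeeping, the orthogonality table and the
double-commutator identity are in `PairLROOnePointWitnessTable.lean`)

Data: Hermitian matrices `H` (Hamiltonian) and `Nop` (a conserved charge), a matrix `P` of charge
`-q ≠ 0` (`Nop P − P Nop = −q P`), a unit vector `ψ` with `H ψ = E ψ`, `Nop ψ = N ψ`. Put
`O = P + Pᴴ`, `w = O ψ`, `a = ‖w‖₂`. Then (Koma–Tasaki 1994 §2.2, the theorem of Horsch and
von der Linden, and the superposition of Kaplan–Horsch–von der Linden 1989):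

* `a² = Re⟨ψ, PᴴP ψ⟩ + Re⟨ψ, PPᴴ ψ⟩` (`eucNorm_sq_add_conjTranspose_mulVec`): the LRO amplitude;
* the unit vector `Ξ = (ψ + w/a)/√2` has
  `Re⟨Ξ, P Ξ⟩ = a/2` (one-point amplitude),
  `⟨Ξ, H Ξ⟩ = E + ⟨w, [H,O]ψ⟩/(2a²)`, hence `Re⟨Ξ, HΞ⟩ ≤ E + ‖[H,O]ψ‖₂/(2a)` (energy: an `O(1)` TOTAL
  excess whenever `‖[H,O]ψ‖₂/a = O(1)`, which locality gives on a lattice),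
  `⟨Ξ, Nop Ξ⟩ = N + q·Re⟨ψ, (PPᴴ − PᴴP)ψ⟩/(2a²)` (charge: shifted by a commutator term),
  `⟨Ξ, X Ξ⟩ = ½⟨ψ, Xψ⟩ + ⟨w, Xw⟩/(2a²)` for every neutral `X` (`X Nop = Nop X`), and
  `T Ξ = c Ξ` for every `T` with `Tψ = cψ` commuting with `P` and `Pᴴ` (translation covariance)
  (`exists_onePointWitness`);
* the double-commutator form `⟨ψ, [O,[H,O]] ψ⟩ = 2(⟨w,Hw⟩ − E a²)` (`dotProduct_doubleCommutator`);
* **the reduction** (`eucNorm_le_two_mul_of_onePointCeiling`): if every unit vector `ζ` with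
  `Re⟨ζ,Hζ⟩ ≤ E + β/(2a₀)` and `|Re⟨ζ, Nop ζ⟩ − N| ≤ |q|γ/(2a₀²)` obeys `Re⟨ζ, Pζ⟩ ≤ M`, where
  `β ≥ ‖[H,O]ψ‖₂`, `γ ≥ |Re⟨ψ,(PPᴴ−PᴴP)ψ⟩|`, `0 < a₀ ≤ a`, then `a ≤ 2M`, i.e.
  `Re⟨ψ,PᴴPψ⟩ + Re⟨ψ,PPᴴψ⟩ ≤ 4M²`.

## Lattice instance (`PairLROOnePointWitnessLattice.lean`)

`Nop = totalNumber`, `P = pairField g L` (charge `-2`, `totalNumber_commutator_localPair`), any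
Hermitian `H` commuting with `totalNumber` (e.g. `hubbardTorusTT' L t t' U`), `ψ` a normalised
ground state in a sector `(N, S^z = M)`: `exists_pairField_onePointWitness` and
`re_expect_pairField_le_of_onePointCeiling` there — in the cell's words: **a certified ceiling `M` on the
one-point `d`-wave amplitude `Re⟨P⟩/L²` over number-INDEFINITE states of energy `≤ E + O(1)` and
mean particle number `N ± O(L⁻²)` gives `⟨P†P⟩/L⁴ + ⟨PP†⟩/L⁴ ≤ 4M²`**, i.e. (with `⟨[P,P†]⟩ = O(L²)`)
`liminf ⟨P†P⟩/L⁴ ≤ 2M²` — the constant of `SourcedOrderDominatesLRO` with the sourced order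
parameter replaced by a direct SDP objective at `h = 0`. The thermodynamic-limit row format and the
locality constants `‖[H,O]ψ‖₂ = O(L²)`, `⟨[P,P†]⟩ = O(L²)` are in neither file.

References: T. Koma, H. Tasaki, J. Stat. Phys. 76 (1994) 745, §2.2 Theorem 2.2 and its proof
(`|⟨Ψ,HΨ⟩ − E| = |⟨[[O,H],O]⟩|/(2‖OΦ‖²)`); T. A. Kaplan, P. Horsch, W. von der Linden, J. Phys.
Soc. Jpn. 58 (1989) 3894 (the superposition `(Φ + Ψ)/√2` and its order parameter); P. Horsch,
W. von der Linden, Z. Phys. B 72 (1988) 181.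
-/

noncomputable section

open Matrix Complex
open scoped ComplexOrder ComplexConjugate

namespace Summit.Ventures.CertifiedManyBodySolver.Observables

open Literature.MathematicalPhysics.QuantumLattice

section Abstract

variable {n : Type*} [Fintype n]

/-- **The source-free one-point witness (Horsch–von der Linden / Kaplan–Horsch–von der Linden).**
`H`, `Nop` Hermitian; `P` of charge `-q ≠ 0` (`Nop P − P Nop = −q P`); `ψ` a unit vector with
`Hψ = Eψ`, `Nop ψ = Nψ` and `w = (P + Pᴴ)ψ ≠ 0`; `a = ‖w‖₂`. Then the unit vector
`Ξ = (ψ + w/a)/√2` satisfies: `Re⟨Ξ,PΞ⟩ = a/2`;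
`⟨Ξ,HΞ⟩ = E + ⟨w,[H,P+Pᴴ]ψ⟩/(2a²)` and `Re⟨Ξ,HΞ⟩ ≤ E + ‖[H,P+Pᴴ]ψ‖₂/(2a)`;
`Re⟨Ξ, Nop Ξ⟩ = N + q Re⟨ψ,(PPᴴ − PᴴP)ψ⟩/(2a²)`; `⟨Ξ,XΞ⟩ = ½⟨ψ,Xψ⟩ + ⟨w,Xw⟩/(2a²)` for neutral `X`;
and `TΞ = cΞ` whenever `Tψ = cψ` and `T` commutes with `P` and `Pᴴ`.
[cite: KomaTasaki1994, Theorem 2.2 (2.9)] [cite: KaplanHorschVonDerLinden1989] -/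
theorem exists_onePointWitness {H Nop P : Matrix n n ℂ} (hH : H.IsHermitian)
    (hNop : Nop.IsHermitian) {q E N : ℝ} (hNP : Nop * P - P * Nop = ((-q : ℝ) : ℂ) • P)
    (hq : q ≠ 0) {ψ : n → ℂ} (hψ : star ψ ⬝ᵥ ψ = 1) (hHψ : H *ᵥ ψ = (E : ℂ) • ψ)
    (hNψ : Nop *ᵥ ψ = (N : ℂ) • ψ) (hw : (P + Pᴴ) *ᵥ ψ ≠ 0) :
    ∃ Ξ : n → ℂ, star Ξ ⬝ᵥ Ξ = 1 ∧
      (star Ξ ⬝ᵥ (P *ᵥ Ξ)).re = eucNorm ((P + Pᴴ) *ᵥ ψ) / 2 ∧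
      star Ξ ⬝ᵥ (H *ᵥ Ξ) = (E : ℂ) +
        star ((P + Pᴴ) *ᵥ ψ) ⬝ᵥ ((H * (P + Pᴴ) - (P + Pᴴ) * H) *ᵥ ψ) /
          (2 * ((eucNorm ((P + Pᴴ) *ᵥ ψ) ^ 2 : ℝ) : ℂ)) ∧
      (star Ξ ⬝ᵥ (H *ᵥ Ξ)).re ≤
        E + eucNorm ((H * (P + Pᴴ) - (P + Pᴴ) * H) *ᵥ ψ) / (2 * eucNorm ((P + Pᴴ) *ᵥ ψ)) ∧
      (star Ξ ⬝ᵥ (Nop *ᵥ Ξ)).re =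
        N + q * (star ψ ⬝ᵥ ((P * Pᴴ - Pᴴ * P) *ᵥ ψ)).re / (2 * eucNorm ((P + Pᴴ) *ᵥ ψ) ^ 2) ∧
      (∀ X : Matrix n n ℂ, X * Nop = Nop * X →
        star Ξ ⬝ᵥ (X *ᵥ Ξ) = star ψ ⬝ᵥ (X *ᵥ ψ) / 2 +
          star ((P + Pᴴ) *ᵥ ψ) ⬝ᵥ (X *ᵥ ((P + Pᴴ) *ᵥ ψ)) /
            (2 * ((eucNorm ((P + Pᴴ) *ᵥ ψ) ^ 2 : ℝ) : ℂ))) ∧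
      (∀ (T : Matrix n n ℂ) (c : ℂ), T *ᵥ ψ = c • ψ → T * P = P * T → T * Pᴴ = Pᴴ * T →
        T *ᵥ Ξ = c • Ξ) := by
  -- notation
  set O : Matrix n n ℂ := P + Pᴴ with hOdef
  set w : n → ℂ := O *ᵥ ψ with hwdef
  set a : ℝ := eucNorm w with hadef
  have hO : O.IsHermitian := by
    rw [hOdef]; exact Matrix.isHermitian_add_transpose_self P
  obtain ⟨t1, t2, t3, t4⟩ := onePointWitness_table hNop hNP hq hNψ
  obtain ⟨-, e1, e2⟩ := onePointWitness_eigen hNop hNP hNψ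
  have ha2 : star w ⬝ᵥ w = ((a ^ 2 : ℝ) : ℂ) := star_dotProduct_self_eq_eucNorm_sq w
  have ha_pos : 0 < a := by
    have h2 : a ^ 2 = (star w ⬝ᵥ w).re := by rw [hadef, eucNorm_sq]
    have hpos : 0 < (star w ⬝ᵥ w).re := by
      have h := Matrix.dotProduct_star_self_pos_iff.2 hw
      exact (Complex.pos_iff.1 h).1
    have ha0 : 0 ≤ a := by rw [hadef]; exact eucNorm_nonneg _
    nlinarith
  have ha0 : a ≠ 0 := ha_pos.ne'
  have ha0c : (a : ℂ) ≠ 0 := by exact_mod_cast ha0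
  -- the witness
  set s : ℝ := (Real.sqrt 2)⁻¹ with hsdef
  set t : ℝ := a⁻¹ with htdef
  have hs2 : (s : ℂ) ^ 2 = 1 / 2 := by
    rw [← Complex.ofReal_pow, hsdef, inv_pow, Real.sq_sqrt (by norm_num : (0:ℝ) ≤ 2)]
    push_cast; ring
  have hta : (t : ℂ) * a = 1 := by
    rw [htdef, Complex.ofReal_inv, inv_mul_cancel₀ ha0c]
  have ht2 : (t : ℂ) ^ 2 = (((a ^ 2 : ℝ) : ℂ))⁻¹ := by
    rw [Complex.ofReal_pow, ← inv_pow, htdef, Complex.ofReal_inv]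
  have ha2c : ((a ^ 2 : ℝ) : ℂ) ≠ 0 := by exact_mod_cast pow_ne_zero 2 ha0
  set Ξ : n → ℂ := (s : ℂ) • (ψ + (t : ℂ) • w) with hΞ
  have hw0 : star w ⬝ᵥ ψ = 0 := by rw [star_dotProduct, t1, star_zero]
  -- (1) norm
  have hnorm : star Ξ ⬝ᵥ Ξ = 1 := by
    rw [hΞ, dotProduct_smul_add_self, hψ, t1, hw0, ha2, hs2, ht2]
    field_simp
    ring
  -- (2) one-point amplitude
  have hOO : star Ξ ⬝ᵥ (O *ᵥ Ξ) = a := by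
    rw [hΞ, dotProduct_mulVec_smul_add, t1, ← hwdef, t3]
    have h4 : star ψ ⬝ᵥ (O *ᵥ w) = star w ⬝ᵥ w := by
      rw [← star_mulVec_dotProduct_of_isHermitian hO, ← hwdef]
    have htc : (t : ℂ) = ((a : ℂ))⁻¹ := by rw [htdef, Complex.ofReal_inv]
    rw [h4, ha2, hs2, htc]
    push_cast
    field_simp
    ring
  have hP : (star Ξ ⬝ᵥ (P *ᵥ Ξ)).re = a / 2 := by
    have hx : star Ξ ⬝ᵥ (Pᴴ *ᵥ Ξ) = star (star Ξ ⬝ᵥ (P *ᵥ Ξ)) := by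
      have hadj : star (P *ᵥ Ξ) ⬝ᵥ Ξ = star Ξ ⬝ᵥ (Pᴴ *ᵥ Ξ) := by
        rw [star_mulVec, ← dotProduct_mulVec]
      rw [← hadj, star_dotProduct]
    have hsplit : star Ξ ⬝ᵥ (O *ᵥ Ξ) = star Ξ ⬝ᵥ (P *ᵥ Ξ) + star (star Ξ ⬝ᵥ (P *ᵥ Ξ)) := by
      rw [hOdef, add_mulVec, dotProduct_add, hx]
    have hre := congrArg Complex.re hsplit
    rw [hOO, Complex.ofReal_re, Complex.add_re, Complex.star_def, Complex.conj_re] at hre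
    linarith
  -- (3) energy identity
  have hHid : star Ξ ⬝ᵥ (H *ᵥ Ξ) =
      (E : ℂ) + star w ⬝ᵥ ((H * O - O * H) *ᵥ ψ) / (2 * ((a ^ 2 : ℝ) : ℂ)) := by
    rw [hΞ, dotProduct_mulVec_smul_add]
    have h1 : star ψ ⬝ᵥ (H *ᵥ ψ) = E := by rw [hHψ, dotProduct_smul, hψ, smul_eq_mul, mul_one]
    have h2 : star ψ ⬝ᵥ (H *ᵥ w) = 0 := by
      rw [← star_mulVec_dotProduct_of_isHermitian hH, hHψ, star_smul, smul_dotProduct, t1,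
        smul_zero]
    have h3 : star w ⬝ᵥ (H *ᵥ ψ) = 0 := by
      rw [hHψ, dotProduct_smul, hw0, smul_zero]
    have h4 : star w ⬝ᵥ (H *ᵥ w) =
        star w ⬝ᵥ ((H * O - O * H) *ᵥ ψ) + (E : ℂ) * (star w ⬝ᵥ w) := by
      rw [sub_mulVec, ← mulVec_mulVec, ← mulVec_mulVec, ← hwdef, hHψ, mulVec_smul, dotProduct_sub,
        dotProduct_smul, smul_eq_mul]
      ring
    rw [h1, h2, h3, h4, ha2, hs2, ht2]
    field_simp
    ring
  -- (4) energy bound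
  have hHle : (star Ξ ⬝ᵥ (H *ᵥ Ξ)).re ≤ E + eucNorm ((H * O - O * H) *ᵥ ψ) / (2 * a) := by
    have hre : (star Ξ ⬝ᵥ (H *ᵥ Ξ)).re =
        E + (star w ⬝ᵥ ((H * O - O * H) *ᵥ ψ)).re / (2 * a ^ 2) := by
      rw [hHid, Complex.add_re, Complex.ofReal_re,
        show (2 * ((a ^ 2 : ℝ) : ℂ)) = ((2 * a ^ 2 : ℝ) : ℂ) by push_cast; ring,
        Complex.div_ofReal_re]
    have hcs : (star w ⬝ᵥ ((H * O - O * H) *ᵥ ψ)).re ≤ a * eucNorm ((H * O - O * H) *ᵥ ψ) :=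
      (Complex.re_le_norm _).trans (by rw [hadef]; exact norm_star_dotProduct_le w _)
    rw [hre]
    have h2a : 0 < 2 * a ^ 2 := by positivity
    calc E + (star w ⬝ᵥ ((H * O - O * H) *ᵥ ψ)).re / (2 * a ^ 2)
        ≤ E + a * eucNorm ((H * O - O * H) *ᵥ ψ) / (2 * a ^ 2) := by gcongr
      _ = E + eucNorm ((H * O - O * H) *ᵥ ψ) / (2 * a) := by
          congr 1; field_simp
  -- (5) number
  have hNid : star Ξ ⬝ᵥ (Nop *ᵥ Ξ) =
      (N : ℂ) + (q : ℂ) * (star ψ ⬝ᵥ ((P * Pᴴ - Pᴴ * P) *ᵥ ψ)) / (2 * ((a ^ 2 : ℝ) : ℂ)) := by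
    rw [hΞ, dotProduct_mulVec_smul_add]
    have h1 : star ψ ⬝ᵥ (Nop *ᵥ ψ) = N := by rw [hNψ, dotProduct_smul, hψ, smul_eq_mul, mul_one]
    have h2 : star ψ ⬝ᵥ (Nop *ᵥ w) = 0 := by
      rw [← star_mulVec_dotProduct_of_isHermitian hNop, hNψ, star_smul, smul_dotProduct, t1,
        smul_zero]
    have h3 : star w ⬝ᵥ (Nop *ᵥ ψ) = 0 := by
      rw [hNψ, dotProduct_smul, hw0, smul_zero]
    have hsum : star ψ ⬝ᵥ ((Pᴴ * P) *ᵥ ψ) + star ψ ⬝ᵥ ((P * Pᴴ) *ᵥ ψ) = ((a ^ 2 : ℝ) : ℂ) := by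
      rw [← t2, ← hwdef, ha2]
    have hdiff : star ψ ⬝ᵥ ((P * Pᴴ - Pᴴ * P) *ᵥ ψ) =
        star ψ ⬝ᵥ ((P * Pᴴ) *ᵥ ψ) - star ψ ⬝ᵥ ((Pᴴ * P) *ᵥ ψ) := by
      rw [sub_mulVec, dotProduct_sub]
    rw [h1, h2, h3, hwdef, t4, hsum, hdiff, hs2, ht2]
    field_simp
    ring
  have hNre : (star Ξ ⬝ᵥ (Nop *ᵥ Ξ)).re =
      N + q * (star ψ ⬝ᵥ ((P * Pᴴ - Pᴴ * P) *ᵥ ψ)).re / (2 * a ^ 2) := by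
    rw [hNid, Complex.add_re, Complex.ofReal_re,
      show (2 * ((a ^ 2 : ℝ) : ℂ)) = ((2 * a ^ 2 : ℝ) : ℂ) by push_cast; ring,
      Complex.div_ofReal_re, Complex.re_ofReal_mul]
  -- (6) neutral observables
  have hX : ∀ X : Matrix n n ℂ, X * Nop = Nop * X →
      star Ξ ⬝ᵥ (X *ᵥ Ξ) = star ψ ⬝ᵥ (X *ᵥ ψ) / 2 +
        star w ⬝ᵥ (X *ᵥ w) / (2 * ((a ^ 2 : ℝ) : ℂ)) := by
    intro X hXN
    rw [hΞ, dotProduct_mulVec_smul_add]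
    have f1 : Nop *ᵥ (X *ᵥ (P *ᵥ ψ)) = ((N + -q : ℝ) : ℂ) • (X *ᵥ (P *ᵥ ψ)) :=
      mulVec_mulVec_eigen_of_commute hXN e1
    have f2 : Nop *ᵥ (X *ᵥ (Pᴴ *ᵥ ψ)) = ((N + q : ℝ) : ℂ) • (X *ᵥ (Pᴴ *ᵥ ψ)) :=
      mulVec_mulVec_eigen_of_commute hXN e2
    have f3 : Nop *ᵥ (X *ᵥ ψ) = (N : ℂ) • (X *ᵥ ψ) := mulVec_mulVec_eigen_of_commute hXN hNψ
    have h2 : star ψ ⬝ᵥ (X *ᵥ w) = 0 := by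
      rw [hwdef, hOdef, add_mulVec, mulVec_add, dotProduct_add,
        dotProduct_eq_zero_of_eigen_ne hNop hNψ f1 (by intro h; apply hq; linarith),
        dotProduct_eq_zero_of_eigen_ne hNop hNψ f2 (by intro h; apply hq; linarith), add_zero]
    have h3 : star w ⬝ᵥ (X *ᵥ ψ) = 0 := by
      rw [hwdef, hOdef, add_mulVec, star_add, add_dotProduct,
        dotProduct_eq_zero_of_eigen_ne hNop e1 f3 (by intro h; apply hq; linarith),
        dotProduct_eq_zero_of_eigen_ne hNop e2 f3 (by intro h; apply hq; linarith), add_zero]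
    rw [h2, h3, hs2, ht2]
    field_simp
    ring
  -- (7) translation covariance
  have hT : ∀ (T : Matrix n n ℂ) (c : ℂ), T *ᵥ ψ = c • ψ → T * P = P * T → T * Pᴴ = Pᴴ * T →
      T *ᵥ Ξ = c • Ξ := by
    intro T c hTψ hTP hTPd
    have hTO : T * O = O * T := by rw [hOdef, Matrix.mul_add, Matrix.add_mul, hTP, hTPd]
    have hTw : T *ᵥ w = c • w := by
      rw [hwdef, mulVec_mulVec, hTO, ← mulVec_mulVec, hTψ, mulVec_smul]
    rw [hΞ, mulVec_smul, mulVec_add, mulVec_smul, hTψ, hTw, smul_comm (t : ℂ) c w, ← smul_add,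
      smul_comm]
  exact ⟨Ξ, hnorm, hP, hHid, hHle, hNre, hX, hT⟩

/-- **The finite-volume reduction: a one-point ceiling over low-energy number-indefinite states is
an LRO ceiling.** With the data of `exists_onePointWitness`, let `β ≥ ‖[H, P+Pᴴ]ψ‖₂`,
`γ ≥ |Re⟨ψ,(PPᴴ − PᴴP)ψ⟩|` and `0 < a₀ ≤ a = ‖(P+Pᴴ)ψ‖₂`. If every unit vector `ζ` with
`Re⟨ζ,Hζ⟩ ≤ E + β/(2a₀)` and `|Re⟨ζ,Nop ζ⟩ − N| ≤ |q|γ/(2a₀²)` has `Re⟨ζ,Pζ⟩ ≤ M`, then `a ≤ 2M`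
(so `Re⟨ψ,PᴴPψ⟩ + Re⟨ψ,PPᴴψ⟩ ≤ 4M²`). [cite: KomaTasaki1994, Theorem 2.2]
[cite: KaplanHorschVonDerLinden1989] -/
theorem eucNorm_le_two_mul_of_onePointCeiling {H Nop P : Matrix n n ℂ} (hH : H.IsHermitian)
    (hNop : Nop.IsHermitian) {q E N : ℝ} (hNP : Nop * P - P * Nop = ((-q : ℝ) : ℂ) • P)
    (hq : q ≠ 0) {ψ : n → ℂ} (hψ : star ψ ⬝ᵥ ψ = 1) (hHψ : H *ᵥ ψ = (E : ℂ) • ψ)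
    (hNψ : Nop *ᵥ ψ = (N : ℂ) • ψ) {β γ a₀ M : ℝ}
    (hβ : eucNorm ((H * (P + Pᴴ) - (P + Pᴴ) * H) *ᵥ ψ) ≤ β)
    (hγ : |(star ψ ⬝ᵥ ((P * Pᴴ - Pᴴ * P) *ᵥ ψ)).re| ≤ γ)
    (ha₀ : 0 < a₀) (ha : a₀ ≤ eucNorm ((P + Pᴴ) *ᵥ ψ))
    (hceil : ∀ ζ : n → ℂ, star ζ ⬝ᵥ ζ = 1 → (star ζ ⬝ᵥ (H *ᵥ ζ)).re ≤ E + β / (2 * a₀) →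
      |(star ζ ⬝ᵥ (Nop *ᵥ ζ)).re - N| ≤ |q| * γ / (2 * a₀ ^ 2) → (star ζ ⬝ᵥ (P *ᵥ ζ)).re ≤ M) :
    eucNorm ((P + Pᴴ) *ᵥ ψ) ≤ 2 * M := by
  set a := eucNorm ((P + Pᴴ) *ᵥ ψ) with hadef
  have ha_pos : 0 < a := lt_of_lt_of_le ha₀ ha
  have hw : (P + Pᴴ) *ᵥ ψ ≠ 0 := by
    intro h
    rw [hadef, h, eucNorm_zero] at ha_pos
    exact lt_irrefl _ ha_pos
  obtain ⟨Ξ, hnorm, hP, -, hHle, hNre, -, -⟩ :=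
    exists_onePointWitness hH hNop hNP hq hψ hHψ hNψ hw
  have hβ0 : 0 ≤ β := (eucNorm_nonneg _).trans hβ
  have hγ0 : 0 ≤ γ := (abs_nonneg _).trans hγ
  have hE : (star Ξ ⬝ᵥ (H *ᵥ Ξ)).re ≤ E + β / (2 * a₀) := by
    refine hHle.trans ?_
    rw [← hadef]
    gcongr
  have hN : |(star Ξ ⬝ᵥ (Nop *ᵥ Ξ)).re - N| ≤ |q| * γ / (2 * a₀ ^ 2) := by
    rw [hNre, ← hadef, add_sub_cancel_left, abs_div, abs_mul, abs_of_pos (by positivity : 0 < 2 * a ^ 2)]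
    calc |q| * |(star ψ ⬝ᵥ ((P * Pᴴ - Pᴴ * P) *ᵥ ψ)).re| / (2 * a ^ 2)
        ≤ |q| * γ / (2 * a ^ 2) := by gcongr
      _ ≤ |q| * γ / (2 * a₀ ^ 2) := by gcongr
  have hM := hceil Ξ hnorm hE hN
  rw [hP] at hM
  linarith

end Abstract

end Summit.Ventures.CertifiedManyBodySolver.Observables

end
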